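import Summits.CriticalPhenomena.PercolationContinuityZ3.Theorems.PercNearOneGluingNoHeavyLowerTailConditionalSelectionHolds
import HarnessLib

/-!
# The CONDITIONAL SELECTION LEMMA for a general increasing cluster target (FINDING-G5 §1 form)

Support file (`--supports stmt-CriticalPhenomena-4575`), prover `prim-ineq-gen-6` (gen 10; memo FINDING-G10 §5).  No
definitions, no named facts, no sorries; standard axioms.

`…ConditionalSelectionHolds.lean` proves the conditional selection lemma at the target `{∋ c}` (registered stub WF).  This file
states and proves it for an ARBITRARY monotone cluster target `T` (`K ⊆ K' → T K → T K'`), which covers the block targets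
`T(K) = (t < |K ∩ A|)` of FINDING-G5 (CSL_t: `Σ_i μ(F_i | |X_{a_i}| ≤ t) ≤ μ(o ↔ A)`, every level `t`; level 1 = Kozma–Nitzan's
Lemma 2) and every increasing target of prim-hp-4's SEL-𝒯 vocabulary: with `δ_a = μ(¬T(C_a))` and the worst-first selection `W`,

  `Σ_{a ∈ A} μ(W = a | ¬T(C_a)) ≤ μ(o ↔ A)`        (`CSLHolds.conditionalSelection`).

Same proof as WF: Kozma–Nitzan's Conjecture 4 (`Q7Psi.kn_conj4_designated`, every weight vector) for the weighted monotone
functional `F(K) = −1{¬T K}·min_{x ∈ K∩A} 1/δ_x`, whose least-mean relay is the δ-largest candidate, and Harris for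
`{o ↔ A}` (increasing) against `{¬T(C_{a₁})}` (decreasing).
[cite: KozmaNitzan2024, Conjecture 4 (p. 32), Lemma 2 (p. 6)] [cite: Harris1960]
-/

noncomputable section

namespace Summit.CriticalPhenomena.PercolationContinuityZ3.Theorems

open MeasureTheory Set Literature.Probability.LatticeModels Literature.Probability.Percolation
open scoped Classical

namespace CSLHolds

variable {n : ℕ}

/-- **THE CONDITIONAL SELECTION LEMMA, general increasing target (FINDING-G5 §1), positive detachments.**
Candidates `A`, observer `o`, a monotone cluster target `T` (e.g. `K ↦ c ∈ K`, `K ↦ t < |K ∩ A|`), detachments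
`δ_a = μ(¬T(C_a)) > 0`, worst-first selection `W` (δ-maximal relay of `o`'s block, smallest index among ties):
`Σ_{a∈A} μ(W = a, ¬T(C_o)) / δ_a ≤ μ(o ↔ A)`, i.e. `Σ_a μ(W = a | ¬T(C_a)) ≤ μ(o ↔ A)`.
Kozma–Nitzan's Conjecture 4 for `F(K) = −1{¬T K}·min_{x ∈ K∩A} 1/δ_x`, plus Harris. [this work]
[cite: KozmaNitzan2024, Conjecture 4 (p. 32), Lemma 2 (p. 6)] [cite: Harris1960] -/
theorem conditionalSelection (w : Sym2 (Fin n) → unitInterval) (A : Finset (Fin n)) (o : Fin n)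
    (T : Set (Fin n) → Prop) (hT : ∀ K K' : Set (Fin n), K ⊆ K' → T K → T K')
    (hpos : ∀ a ∈ A, 0 < (prodBernoulli w).real {ω : BondConfig (Fin n) | ¬ T (openCluster ω a)}) :
    (∑ a ∈ A, (prodBernoulli w).real
        {ω : BondConfig (Fin n) | ω ∈ openConn o a ∧ ¬ T (openCluster ω o) ∧
          ∀ x ∈ A, ω ∈ openConn o x →
            ((prodBernoulli w).real {ω : BondConfig (Fin n) | ¬ T (openCluster ω x)} <
                (prodBernoulli w).real {ω : BondConfig (Fin n) | ¬ T (openCluster ω a)} ∨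
              ((prodBernoulli w).real {ω : BondConfig (Fin n) | ¬ T (openCluster ω x)} =
                  (prodBernoulli w).real {ω : BondConfig (Fin n) | ¬ T (openCluster ω a)} ∧ a ≤ x))} /
        (prodBernoulli w).real {ω : BondConfig (Fin n) | ¬ T (openCluster ω a)}) ≤
      (prodBernoulli w).real (⋃ a ∈ A, (openConn o a : Set (BondConfig (Fin n)))) := by
  -- the target events are increasing
  have hTup : ∀ a : Fin n, IsUpperSet {ω : BondConfig (Fin n) | T (openCluster ω a)} := by
    intro a ω ω' hle hω
    exact hT _ _ (fun y hy => isUpperSet_openConn a y hle hy) hω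
  set μ := prodBernoulli w with hμ
  haveI : IsProbabilityMeasure μ := by rw [hμ]; infer_instance
  have hmeas : ∀ S : Set (BondConfig (Fin n)), MeasurableSet S := fun _ => MeasurableSet.of_discrete
  have hint : ∀ (g : BondConfig (Fin n) → ℝ), Integrable g μ := fun g => Integrable.of_finite
  -- detachments
  set δ : Fin n → ℝ := fun a => μ.real {ω : BondConfig (Fin n) | ¬ T (openCluster ω a)} with hδ
  set U : Set (BondConfig (Fin n)) := ⋃ a ∈ A, (openConn o a : Set (BondConfig (Fin n))) with hU
  -- the selected events
  set W : Fin n → Set (BondConfig (Fin n)) := fun a =>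
    {ω : BondConfig (Fin n) | ω ∈ openConn o a ∧ ¬ T (openCluster ω o) ∧
      ∀ x ∈ A, ω ∈ openConn o x → (δ x < δ a ∨ (δ x = δ a ∧ a ≤ x))} with hW
  change (∑ a ∈ A, μ.real (W a) / δ a) ≤ μ.real U
  rcases A.eq_empty_or_nonempty with hAe | hAne
  · rw [hAe, Finset.sum_empty]; exact measureReal_nonneg
  -- the globally worst relay `a₁`
  obtain ⟨a₁, ha₁, hworst₁⟩ := worst_exists δ A hAne
  have hle₁ : ∀ x ∈ A, δ x ≤ δ a₁ := fun x hx => by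
    rcases hworst₁ x hx with h | ⟨h, _⟩
    · exact h.le
    · exact h.le
  have hδpos : ∀ a ∈ A, 0 < δ a := hpos
  have hδ₁ : 0 < δ a₁ := hδpos a₁ ha₁
  -- the weights `1/δ` and the cap `M`
  set M : ℝ := ∑ x ∈ A, 1 / δ x with hM
  have hinvM : ∀ x ∈ A, 1 / δ x ≤ M := fun x hx =>
    Finset.single_le_sum (f := fun x => 1 / δ x) (fun y hy => (one_div_pos.2 (hδpos y hy)).le) hx
  -- `m(S) = min_{x ∈ S ∩ A} 1/δ_x` (or `M`)
  set m : Set (Fin n) → ℝ := fun S =>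
    if h : (A.filter fun x => x ∈ S).Nonempty then (A.filter fun x => x ∈ S).inf' h (fun x => 1 / δ x) else M
    with hm
  have hm1 : ∀ (S : Set (Fin n)), ∀ a ∈ A, a ∈ S → m S ≤ 1 / δ a := by
    intro S a ha haS
    have hmem : a ∈ A.filter fun x => x ∈ S := Finset.mem_filter.2 ⟨ha, haS⟩
    have hne : (A.filter fun x => x ∈ S).Nonempty := ⟨a, hmem⟩
    simp only [hm, dif_pos hne]
    exact Finset.inf'_le _ hmem
  have hm2 : ∀ S : Set (Fin n), 1 / δ a₁ ≤ m S := by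
    intro S
    by_cases hne : (A.filter fun x => x ∈ S).Nonempty
    · simp only [hm, dif_pos hne]
      refine Finset.le_inf' hne _ fun x hx => ?_
      have hxA : x ∈ A := (Finset.mem_filter.1 hx).1
      exact one_div_le_one_div_of_le (hδpos x hxA) (hle₁ x hxA)
    · simp only [hm, dif_neg hne]
      exact hinvM a₁ ha₁
  have hm0 : ∀ S : Set (Fin n), 0 ≤ m S := fun S => (one_div_pos.2 hδ₁).le.trans (hm2 S)
  have hm3 : ∀ S T : Set (Fin n), S ⊆ T → m T ≤ m S := by
    intro S T hST
    by_cases hneS : (A.filter fun x => x ∈ S).Nonempty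
    · have hsub : (A.filter fun x => x ∈ S) ⊆ (A.filter fun x => x ∈ T) :=
        Finset.monotone_filter_right A fun _ _ hx => hST hx
      have hneT : (A.filter fun x => x ∈ T).Nonempty := hneS.mono hsub
      simp only [hm, dif_pos hneS, dif_pos hneT]
      refine Finset.le_inf' hneS _ fun x hx => ?_
      exact Finset.inf'_le _ (hsub hx)
    · simp only [hm, dif_neg hneS]
      by_cases hneT : (A.filter fun x => x ∈ T).Nonempty
      · simp only [dif_pos hneT]
        obtain ⟨x, hx⟩ := hneT
        exact (Finset.inf'_le _ hx).trans (hinvM x (Finset.mem_filter.1 hx).1)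
      · simp only [dif_neg hneT]; exact le_refl _
  -- the functional
  set F : Set (Fin n) → ℝ := fun S => if T S then 0 else -m S with hF
  have hFmono : ∀ S S' : Set (Fin n), S ⊆ S' → F S ≤ F S' := by
    intro S S' hST
    by_cases hcT : T S'
    · simp only [hF, if_pos hcT]
      by_cases hcS : T S
      · simp only [if_pos hcS]; exact le_refl _
      · simp only [if_neg hcS]; linarith [hm0 S]
    · have hcS : ¬ T S := fun h => hcT (hT S S' hST h)
      simp only [hF, if_neg hcT, if_neg hcS]
      linarith [hm3 S S' hST]
  -- designated least-mean relay: `E F(C a₁) ≤ -1 ≤ E F(C a)`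
  have hlow : ∀ a ∈ A, -1 ≤ ∫ ω, F (openCluster ω a) ∂μ := by
    intro a ha
    have hpt : ∀ ω, ({ω : BondConfig (Fin n) | ¬ T (openCluster ω a)} : Set (BondConfig (Fin n))).indicator (fun _ => -(1 / δ a)) ω ≤
        F (openCluster ω a) := by
      intro ω
      by_cases hca : T (openCluster ω a)
      · have hω : ω ∉ ({ω : BondConfig (Fin n) | ¬ T (openCluster ω a)} : Set (BondConfig (Fin n))) := fun h => h hca
        rw [Set.indicator_of_notMem hω]
        simp only [hF, if_pos hca]; exact le_refl _
      · have hω : ω ∈ ({ω : BondConfig (Fin n) | ¬ T (openCluster ω a)} : Set (BondConfig (Fin n))) := hca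
        rw [Set.indicator_of_mem hω]
        simp only [hF, if_neg hca]
        linarith [hm1 (openCluster ω a) a ha (mem_openCluster_self ω a)]
    have hI := integral_mono (hint _) (hint _) hpt
    rw [integral_indicator_const _ (hmeas _), smul_eq_mul] at hI
    have hδa : δ a ≠ 0 := (hδpos a ha).ne'
    have : μ.real {ω : BondConfig (Fin n) | ¬ T (openCluster ω a)} * -(1 / δ a) = -1 := by
      change δ a * -(1 / δ a) = -1
      field_simp
    linarith
  have hup : ∫ ω, F (openCluster ω a₁) ∂μ ≤ -1 := by
    have hpt : ∀ ω, F (openCluster ω a₁) ≤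
        ({ω : BondConfig (Fin n) | ¬ T (openCluster ω a₁)} : Set (BondConfig (Fin n))).indicator (fun _ => -(1 / δ a₁)) ω := by
      intro ω
      by_cases hca : T (openCluster ω a₁)
      · have hω : ω ∉ ({ω : BondConfig (Fin n) | ¬ T (openCluster ω a₁)} : Set (BondConfig (Fin n))) := fun h => h hca
        rw [Set.indicator_of_notMem hω]
        simp only [hF, if_pos hca]; exact le_refl _
      · have hω : ω ∈ ({ω : BondConfig (Fin n) | ¬ T (openCluster ω a₁)} : Set (BondConfig (Fin n))) := hca
        rw [Set.indicator_of_mem hω]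
        simp only [hF, if_neg hca]
        linarith [hm2 (openCluster ω a₁)]
    have hI := integral_mono (hint _) (hint _) hpt
    rw [integral_indicator_const _ (hmeas _), smul_eq_mul] at hI
    have : μ.real {ω : BondConfig (Fin n) | ¬ T (openCluster ω a₁)} * -(1 / δ a₁) = -1 := by
      change δ a₁ * -(1 / δ a₁) = -1
      field_simp
    linarith
  have hmin : ∀ a ∈ A, ∫ ω, F (openCluster ω a₁) ∂μ ≤ ∫ ω, F (openCluster ω a) ∂μ :=
    fun a ha => hup.trans (hlow a ha)
  -- Conjecture 4, designated form
  have key := Q7Psi.kn_conj4_designated w A o a₁ F hFmono ha₁ hmin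
  rw [← hμ] at key
  change ∫ ω in U, F (openCluster ω a₁) ∂μ ≤ ∫ ω in U, F (openCluster ω o) ∂μ at key
  -- upper bound for the observer side: `∫_U F(C_o) ≤ -Σ_a μ(W_a)/δ_a`
  have hobs : ∫ ω in U, F (openCluster ω o) ∂μ ≤ -∑ a ∈ A, μ.real (W a) * (1 / δ a) := by
    rw [← integral_indicator (hmeas U)]
    have hpt : ∀ ω, U.indicator (fun ω => F (openCluster ω o)) ω ≤
        -∑ a ∈ A, (W a).indicator (fun _ => 1 / δ a) ω := by
      intro ω
      by_cases hωU : ω ∈ U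
      · rw [Set.indicator_of_mem hωU]
        by_cases hoc : T (openCluster ω o)
        · -- every `W_a` fails
          have hzero : ∀ a ∈ A, (W a).indicator (fun _ => 1 / δ a) ω = 0 := by
            intro a _
            exact Set.indicator_of_notMem (fun h => h.2.1 hoc) _
          rw [Finset.sum_congr rfl hzero, Finset.sum_const_zero, neg_zero]
          simp only [hF, if_pos hoc]; exact le_refl _
        · simp only [hF, if_neg hoc]
          by_cases hex : ∃ a ∈ A, ω ∈ W a
          · obtain ⟨a, ha, hωa⟩ := hex
            have hsum : ∑ x ∈ A, (W x).indicator (fun _ => 1 / δ x) ω = 1 / δ a := by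
              rw [Finset.sum_eq_single_of_mem a ha]
              · exact Set.indicator_of_mem hωa _
              · intro b hb hba
                refine Set.indicator_of_notMem (fun hωb => hba ?_) _
                -- uniqueness of the worst element of `π(o)`
                have hbB : b ∈ A.filter fun x => ω ∈ openConn o x := Finset.mem_filter.2 ⟨hb, hωb.1⟩
                have haB : a ∈ A.filter fun x => ω ∈ openConn o x := Finset.mem_filter.2 ⟨ha, hωa.1⟩
                exact worst_unique δ (A.filter fun x => ω ∈ openConn o x) hbB haB
                  (fun x hx => hωb.2.2 x (Finset.mem_filter.1 hx).1 (Finset.mem_filter.1 hx).2)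
                  (fun x hx => hωa.2.2 x (Finset.mem_filter.1 hx).1 (Finset.mem_filter.1 hx).2)
            rw [hsum]
            -- `1/δ_a ≤ m(C_o)`: `a` has the largest `δ` in `π(o)`
            have hne : (A.filter fun x => x ∈ openCluster ω o).Nonempty :=
              ⟨a, Finset.mem_filter.2 ⟨ha, hωa.1⟩⟩
            have hle : 1 / δ a ≤ m (openCluster ω o) := by
              simp only [hm, dif_pos hne]
              refine Finset.le_inf' hne _ fun x hx => ?_
              have hxA : x ∈ A := (Finset.mem_filter.1 hx).1
              have hox : ω ∈ openConn o x := (Finset.mem_filter.1 hx).2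
              have hδle : δ x ≤ δ a := by
                rcases hωa.2.2 x hxA hox with h | ⟨h, _⟩
                · exact h.le
                · exact h.le
              exact one_div_le_one_div_of_le (hδpos x hxA) hδle
            linarith
          · push Not at hex
            have hzero : ∀ a ∈ A, (W a).indicator (fun _ => 1 / δ a) ω = 0 := fun a ha =>
              Set.indicator_of_notMem (hex a ha) _
            rw [Finset.sum_congr rfl hzero, Finset.sum_const_zero, neg_zero]
            linarith [hm0 (openCluster ω o)]
      · rw [Set.indicator_of_notMem hωU]
        have hzero : ∀ a ∈ A, (W a).indicator (fun _ => 1 / δ a) ω = 0 := by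
          intro a ha
          refine Set.indicator_of_notMem (fun h => hωU ?_) _
          exact Set.mem_iUnion₂.2 ⟨a, ha, h.1⟩
        rw [Finset.sum_congr rfl hzero, Finset.sum_const_zero, neg_zero]
    have hI := integral_mono (hint _) (hint _) hpt
    rw [integral_neg, integral_sum_indicator] at hI
    exact hI
  -- lower bound for the relay side: `∫_U F(C a₁) ≥ -μ(U ∩ {a₁ ↮ c})/δ_{a₁}`
  have hrel : -(μ.real (U ∩ {ω : BondConfig (Fin n) | ¬ T (openCluster ω a₁)}) * (1 / δ a₁)) ≤
      ∫ ω in U, F (openCluster ω a₁) ∂μ := by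
    rw [← integral_indicator (hmeas U)]
    have hpt : ∀ ω, (U ∩ {ω : BondConfig (Fin n) | ¬ T (openCluster ω a₁)}).indicator (fun _ => -(1 / δ a₁)) ω ≤
        U.indicator (fun ω => F (openCluster ω a₁)) ω := by
      intro ω
      by_cases hωU : ω ∈ U
      · rw [Set.indicator_of_mem hωU]
        by_cases hca : T (openCluster ω a₁)
        · have hω : ω ∉ U ∩ {ω : BondConfig (Fin n) | ¬ T (openCluster ω a₁)} := fun h => h.2 hca
          rw [Set.indicator_of_notMem hω]
          simp only [hF, if_pos hca]; exact le_refl _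
        · have hω : ω ∈ U ∩ {ω : BondConfig (Fin n) | ¬ T (openCluster ω a₁)} := ⟨hωU, hca⟩
          rw [Set.indicator_of_mem hω]
          simp only [hF, if_neg hca]
          linarith [hm1 (openCluster ω a₁) a₁ ha₁ (mem_openCluster_self ω a₁)]
      · rw [Set.indicator_of_notMem hωU]
        have hω : ω ∉ U ∩ {ω : BondConfig (Fin n) | ¬ T (openCluster ω a₁)} := fun h => hωU h.1
        rw [Set.indicator_of_notMem hω]
    have hI := integral_mono (hint _) (hint _) hpt
    rw [integral_indicator_const _ (hmeas _), smul_eq_mul] at hI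
    linarith
  -- Harris: `{o ↔ A}` increasing, `{a₁ ↮ c}` decreasing
  have hharris : μ.real (U ∩ {ω : BondConfig (Fin n) | ¬ T (openCluster ω a₁)}) ≤ μ.real U * δ a₁ :=
    prodBernoulli_harris_upper_lower w (QuantGapPlusOne.isUpperSet_touch A o) (hTup a₁).compl
      (hmeas _) (hmeas _)
  -- assemble
  have hsum_eq : (∑ a ∈ A, μ.real (W a) / δ a) = ∑ a ∈ A, μ.real (W a) * (1 / δ a) :=
    Finset.sum_congr rfl fun a _ => by rw [div_eq_mul_one_div]
  rw [hsum_eq]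
  have h1 : (∑ a ∈ A, μ.real (W a) * (1 / δ a)) ≤
      μ.real (U ∩ {ω : BondConfig (Fin n) | ¬ T (openCluster ω a₁)}) * (1 / δ a₁) := by linarith
  have h2 : μ.real (U ∩ {ω : BondConfig (Fin n) | ¬ T (openCluster ω a₁)}) * (1 / δ a₁) ≤
      μ.real U * δ a₁ * (1 / δ a₁) :=
    mul_le_mul_of_nonneg_right hharris (one_div_pos.2 hδ₁).le
  have h3 : μ.real U * δ a₁ * (1 / δ a₁) = μ.real U := by field_simp
  linarith


end CSLHolds

end Summit.CriticalPhenomena.PercolationContinuityZ3.Theorems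

end
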